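import Summits.CriticalPhenomena.Ising3DConformalLimit.Theorems.UnitLightConeUnitSpeedTwoPointBesselKHalfLaplace
import Summits.CriticalPhenomena.Ising3DConformalLimit.Theorems.UnitLightConeUnitSpeedTwoPointBesselKNegHalfLaplace
import Summits.CriticalPhenomena.Ising3DConformalLimit.Theorems.UnitLightConeUnitSpeedTwoPointGaussianCosFourierPlane
import HarnessLib

/-!
# Stub B `stub_sommerfeldWeyl` of line `yukawa_subordination` — crux `UnitSpeedTwoPoint`
(route UnitLightCone, item stmt-CriticalPhenomena-17167)

The **Sommerfeld–Weyl mixed representation of the Yukawa potential in `d = 3`**: for `m ≥ 0`, `t ≠ 0`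
and `a b : ℝ`, with `Ω(k) = √(‖k‖² + m²)` on `ℝ² = EuclideanSpace ℝ (Fin 2)`,

  `k ↦ e^{-Ω|t|}/Ω` is integrable and `∫ cos(k₀a + k₁b) e^{-Ω|t|}/Ω d²k = 2π e^{-mr}/r`,
  `r = √(a² + b² + t²)`

(the `p₃`-integral of the Fourier representation `e^{-mr}/(4πr) = ∫ e^{ip·x}(p² + m²)⁻¹ d³p/(2π)³`;
`m = 0` is Weyl's integral for `1/r`).  Proof by GAUSSIAN SUBORDINATION, Bessel-free:

1. `e^{-Ω|t|}/Ω = π^{-1/2} ∫₀^∞ u^{-1/2} e^{-t²/(4u)} e^{-uΩ²} du` (`Ω > 0`) — the landed helper stub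
   `stub_besselKHalfLaplace` (`K_{1/2}`) at `α = Ω²`, `β = t²/4`;
2. the integrand `cos(k·w) u^{-1/2} e^{-t²/(4u)} e^{-u(‖k‖²+m²)}` is integrable on `ℝ² × (0,∞)`
   (`integrable_prod_iff'`: Gaussian sections, norm integral `= π u^{-3/2} e^{-t²/(4u) - um²}`,
   integrable by `stub_besselKNegHalfLaplace`), so the two iterated integrals agree (`integral_prod`,
   `integral_prod_symm`);
3. `∫ cos(k₀a + k₁b) e^{-u‖k‖²} d²k = (π/u) e^{-(a²+b²)/(4u)}` — the landed helper stub
   `stub_gaussianCosFourierPlane`;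
4. `√π ∫₀^∞ u^{-3/2} e^{-r²/(4u)} e^{-um²} du = 2π e^{-mr}/r` — `stub_besselKNegHalfLaplace` (`K_{-1/2}`,
   incl. `m = 0`) at `α = m²`, `β = r²/4`.

Integrability of `e^{-Ω|t|}/Ω` is read off the same Fubini statement (`Integrable.integral_prod_left`)
at `a.e. k` (`Ω(k) > 0` off `k = 0`).  Sources: Watson, *Bessel Functions* §13.47 (Sommerfeld's integral);
Stein–Weiss 1971 Ch. I §1 (subordination of the Poisson kernel); Glimm–Jaffe 1987 §7.2.
-/

noncomputable section

open MeasureTheory Set Filter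

namespace Summit.CriticalPhenomena.Ising3DConformalLimit.Cruxes.UnitSpeedTwoPoint.YukawaSubordination

/-- **Subordination of `e^{-Ω|t|}/Ω` to Gaussians** (`K_{1/2}`): for `Ω > 0`, `t ≠ 0`,
`u ↦ u^{-1/2} e^{-(t²/(4u) + uΩ²)}` is integrable on `(0,∞)` and
`∫₀^∞ u^{-1/2} e^{-(t²/(4u) + uΩ²)} du = √π e^{-Ω|t|}/Ω`. [folklore] -/
theorem sommerfeldWeyl_subordination {Ω t : ℝ} (hΩ : 0 < Ω) (ht : t ≠ 0) :
    IntegrableOn (fun u : ℝ => (Real.sqrt u)⁻¹ * Real.exp (-(t ^ 2 / 4 * u⁻¹ + Ω ^ 2 * u)))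
        (Ioi 0) ∧
      ∫ u in Ioi (0 : ℝ), (Real.sqrt u)⁻¹ * Real.exp (-(t ^ 2 / 4 * u⁻¹ + Ω ^ 2 * u)) =
        Real.sqrt Real.pi * Real.exp (-(Ω * |t|)) / Ω := by
  have ht2 : 0 < t ^ 2 / 4 := by positivity
  obtain ⟨hi, hv⟩ := stub_besselKHalfLaplace (Ω ^ 2) (t ^ 2 / 4) (by positivity) ht2
  refine ⟨hi, ?_⟩
  rw [hv]
  have h1 : Real.sqrt (Ω ^ 2 * (t ^ 2 / 4)) = Ω * |t| / 2 := by
    rw [show Ω ^ 2 * (t ^ 2 / 4) = (Ω * |t| / 2) ^ 2 by rw [div_pow, mul_pow, sq_abs]; ring,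
      Real.sqrt_sq (by positivity)]
  have h2 : Real.sqrt (Real.pi / Ω ^ 2) = Real.sqrt Real.pi / Ω := by
    rw [Real.sqrt_div' _ (sq_nonneg Ω), Real.sqrt_sq hΩ.le]
  rw [h1, h2, show 2 * (Ω * |t| / 2) = Ω * |t| by ring]
  ring

/-- **Gaussian sections.** For `u > 0` the section `k ↦ u^{-1/2} e^{-(t²/(4u) + u(‖k‖² + m²))}` is
integrable on `ℝ²` and its cosine transform is
`u^{-1/2} e^{-(t²/(4u) + um²)} · (π/u) e^{-(a²+b²)/(4u)}` (Gaussian Fourier transform on the plane).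
[folklore] -/
theorem sommerfeldWeyl_gauss_section {u : ℝ} (hu : 0 < u) (m t a b : ℝ) :
    Integrable (fun k : EuclideanSpace ℝ (Fin 2) =>
        (Real.sqrt u)⁻¹ * Real.exp (-(t ^ 2 / 4 * u⁻¹ + (‖k‖ ^ 2 + m ^ 2) * u))) ∧
      ∫ k : EuclideanSpace ℝ (Fin 2), Real.cos (k 0 * a + k 1 * b) *
          ((Real.sqrt u)⁻¹ * Real.exp (-(t ^ 2 / 4 * u⁻¹ + (‖k‖ ^ 2 + m ^ 2) * u))) =
        (Real.sqrt u)⁻¹ * Real.exp (-(t ^ 2 / 4 * u⁻¹ + m ^ 2 * u)) *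
          (Real.pi / u * Real.exp (-((a ^ 2 + b ^ 2) / (4 * u)))) := by
  obtain ⟨hgi, hgv⟩ := stub_gaussianCosFourierPlane u a b hu
  have hpt : ∀ k : EuclideanSpace ℝ (Fin 2),
      (Real.sqrt u)⁻¹ * Real.exp (-(t ^ 2 / 4 * u⁻¹ + (‖k‖ ^ 2 + m ^ 2) * u)) =
        (Real.sqrt u)⁻¹ * Real.exp (-(t ^ 2 / 4 * u⁻¹ + m ^ 2 * u)) *
          Real.exp (-(u * ‖k‖ ^ 2)) := by
    intro k
    rw [mul_assoc, ← Real.exp_add]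
    congr 2
    ring
  refine ⟨(hgi.const_mul ((Real.sqrt u)⁻¹ * Real.exp (-(t ^ 2 / 4 * u⁻¹ + m ^ 2 * u)))).congr
    (ae_of_all _ fun k => (hpt k).symm), ?_⟩
  have hpt' : ∀ k : EuclideanSpace ℝ (Fin 2), Real.cos (k 0 * a + k 1 * b) *
      ((Real.sqrt u)⁻¹ * Real.exp (-(t ^ 2 / 4 * u⁻¹ + (‖k‖ ^ 2 + m ^ 2) * u))) =
        (Real.sqrt u)⁻¹ * Real.exp (-(t ^ 2 / 4 * u⁻¹ + m ^ 2 * u)) *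
          (Real.cos (k 0 * a + k 1 * b) * Real.exp (-(u * ‖k‖ ^ 2))) := by
    intro k
    rw [hpt k]
    ring
  simp_rw [hpt']
  rw [integral_const_mul, hgv]

/-- **Integrability of the radial `u`-integrand** (`K_{-1/2}` at `α = m²`, `β = t²/4`):
`u ↦ u^{-1/2} e^{-(t²/(4u) + um²)} · π/u` is integrable on `(0,∞)` for `t ≠ 0`. [folklore] -/
theorem sommerfeldWeyl_radial_integrable (m : ℝ) {t : ℝ} (ht : t ≠ 0) :
    IntegrableOn (fun u : ℝ =>
        (Real.sqrt u)⁻¹ * Real.exp (-(t ^ 2 / 4 * u⁻¹ + m ^ 2 * u)) * (Real.pi / u)) (Ioi 0) := by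
  have ht2 : 0 < t ^ 2 / 4 := by positivity
  have h := (stub_besselKNegHalfLaplace (m ^ 2) (t ^ 2 / 4) (sq_nonneg m) ht2).1
  refine IntegrableOn.congr_fun (h.const_mul Real.pi) (fun u _ => ?_) measurableSet_Ioi
  ring

/-- **The radial `u`-integral** (`K_{-1/2}` at `α = m²`, `β = r²/4`, `r² = a² + b² + t²`): for `m ≥ 0`,
`t ≠ 0`, `∫₀^∞ u^{-1/2} e^{-(t²/(4u) + um²)} (π/u) e^{-(a²+b²)/(4u)} du = 2π√π e^{-mr}/r`. [folklore] -/
theorem sommerfeldWeyl_radial_integral {m t : ℝ} (hm : 0 ≤ m) (ht : t ≠ 0) (a b : ℝ) :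
    ∫ u in Ioi (0 : ℝ), (Real.sqrt u)⁻¹ * Real.exp (-(t ^ 2 / 4 * u⁻¹ + m ^ 2 * u)) *
        (Real.pi / u * Real.exp (-((a ^ 2 + b ^ 2) / (4 * u)))) =
      2 * Real.pi * Real.sqrt Real.pi * Real.exp (-(m * Real.sqrt (a ^ 2 + b ^ 2 + t ^ 2))) /
        Real.sqrt (a ^ 2 + b ^ 2 + t ^ 2) := by
  set s : ℝ := a ^ 2 + b ^ 2 + t ^ 2 with hs
  have hs0 : 0 < s := by
    have : 0 < t ^ 2 := by positivity
    rw [hs]; positivity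
  have hs4 : 0 < s / 4 := by positivity
  have hpt : ∀ u ∈ Ioi (0 : ℝ), (Real.sqrt u)⁻¹ * Real.exp (-(t ^ 2 / 4 * u⁻¹ + m ^ 2 * u)) *
      (Real.pi / u * Real.exp (-((a ^ 2 + b ^ 2) / (4 * u)))) =
        Real.pi * ((Real.sqrt u)⁻¹ * u⁻¹ * Real.exp (-(s / 4 * u⁻¹ + m ^ 2 * u))) := by
    intro u _
    have he : Real.exp (-(t ^ 2 / 4 * u⁻¹ + m ^ 2 * u)) * Real.exp (-((a ^ 2 + b ^ 2) / (4 * u))) =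
        Real.exp (-(s / 4 * u⁻¹ + m ^ 2 * u)) := by
      rw [← Real.exp_add, hs]
      congr 1
      ring
    calc (Real.sqrt u)⁻¹ * Real.exp (-(t ^ 2 / 4 * u⁻¹ + m ^ 2 * u)) *
          (Real.pi / u * Real.exp (-((a ^ 2 + b ^ 2) / (4 * u))))
        = Real.pi * ((Real.sqrt u)⁻¹ * u⁻¹ * (Real.exp (-(t ^ 2 / 4 * u⁻¹ + m ^ 2 * u)) *
            Real.exp (-((a ^ 2 + b ^ 2) / (4 * u))))) := by ring
      _ = _ := by rw [he]
  rw [setIntegral_congr_fun measurableSet_Ioi hpt, integral_const_mul,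
    (stub_besselKNegHalfLaplace (m ^ 2) (s / 4) (sq_nonneg m) hs4).2]
  have h4 : Real.sqrt 4 = 2 := by
    rw [show (4 : ℝ) = 2 ^ 2 by norm_num, Real.sqrt_sq (by norm_num)]
  have h1 : Real.sqrt (Real.pi / (s / 4)) = 2 * Real.sqrt Real.pi / Real.sqrt s := by
    rw [Real.sqrt_div' _ hs4.le, Real.sqrt_div' _ (by norm_num : (0:ℝ) ≤ 4), h4]
    have : Real.sqrt s ≠ 0 := (Real.sqrt_pos.2 hs0).ne'
    field_simp
  have h2 : Real.sqrt (m ^ 2 * (s / 4)) = m * Real.sqrt s / 2 := by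
    rw [Real.sqrt_mul (sq_nonneg m), Real.sqrt_sq hm, Real.sqrt_div' _ (by norm_num : (0:ℝ) ≤ 4),
      h4]
    ring
  rw [h1, h2, show 2 * (m * Real.sqrt s / 2) = m * Real.sqrt s by ring]
  ring

/-- Off the origin of `ℝ²` almost everywhere (Lebesgue measure has no atoms). [folklore] -/
theorem sommerfeldWeyl_ae_ne_zero :
    ∀ᵐ k ∂(volume : Measure (EuclideanSpace ℝ (Fin 2))), k ≠ 0 := by
  rw [ae_iff]
  simp only [ne_eq, not_not, setOf_eq_eq_singleton, measure_singleton]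

/-- Registered stub B `stub_sommerfeldWeyl` — **Sommerfeld–Weyl mixed representation of the Yukawa
potential**: for `m ≥ 0`, `t ≠ 0` and `a b : ℝ`, with `Ω(k) = √(‖k‖² + m²)` on `EuclideanSpace ℝ (Fin 2)`,
`k ↦ e^{-Ω|t|}/Ω` is integrable and `∫ cos(k₀ a + k₁ b) e^{-Ω|t|}/Ω d²k = 2π e^{-m r}/r`,
`r = √(a² + b² + t²)`.  Proof: Gaussian subordination (`sommerfeldWeyl_subordination`), Fubini on
`ℝ² × (0,∞)` (`integrable_prod_iff'`, `integral_prod`, `integral_prod_symm`), the Gaussian cosine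
transform (`sommerfeldWeyl_gauss_section`) and the `K_{-1/2}` integral (`sommerfeldWeyl_radial_integral`).
[folklore] -/
theorem stub_sommerfeldWeyl :
    ∀ m t a b : ℝ, 0 ≤ m → t ≠ 0 →
      MeasureTheory.Integrable (fun k : EuclideanSpace ℝ (Fin 2) =>
          Real.exp (-(Real.sqrt (‖k‖ ^ 2 + m ^ 2) * |t|)) / Real.sqrt (‖k‖ ^ 2 + m ^ 2)) ∧
        ∫ k : EuclideanSpace ℝ (Fin 2), Real.cos (k 0 * a + k 1 * b) *
            (Real.exp (-(Real.sqrt (‖k‖ ^ 2 + m ^ 2) * |t|)) / Real.sqrt (‖k‖ ^ 2 + m ^ 2)) =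
          2 * Real.pi * Real.exp (-(m * Real.sqrt (a ^ 2 + b ^ 2 + t ^ 2))) /
            Real.sqrt (a ^ 2 + b ^ 2 + t ^ 2) := by
  intro m t a b hm ht
  -- the measures: Lebesgue on `ℝ²` and on `(0, ∞)`
  set ν : Measure ℝ := volume.restrict (Ioi (0 : ℝ)) with hν
  -- the subordination integrand `F` and its nonnegative majorant `G`
  set G : EuclideanSpace ℝ (Fin 2) × ℝ → ℝ := fun p =>
    (Real.sqrt p.2)⁻¹ * Real.exp (-(t ^ 2 / 4 * p.2⁻¹ + (‖p.1‖ ^ 2 + m ^ 2) * p.2)) with hG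
  set F : EuclideanSpace ℝ (Fin 2) × ℝ → ℝ := fun p =>
    Real.cos (p.1 0 * a + p.1 1 * b) * G p with hF
  have hGm : Measurable G := by rw [hG]; fun_prop
  have hFm : Measurable F := by rw [hF, hG]; fun_prop
  -- `Ω(k) > 0` for a.e. `k`
  have hΩae : ∀ᵐ k ∂(volume : Measure (EuclideanSpace ℝ (Fin 2))),
      0 < Real.sqrt (‖k‖ ^ 2 + m ^ 2) := by
    filter_upwards [sommerfeldWeyl_ae_ne_zero] with k hk
    have : 0 < ‖k‖ := norm_pos_iff.2 hk
    positivity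
  -- the `u`-integral of `G(k, ·)` (subordination), for `Ω(k) > 0`
  have hGu : ∀ k : EuclideanSpace ℝ (Fin 2), 0 < Real.sqrt (‖k‖ ^ 2 + m ^ 2) →
      ∫ u, G (k, u) ∂ν = Real.sqrt Real.pi *
        Real.exp (-(Real.sqrt (‖k‖ ^ 2 + m ^ 2) * |t|)) / Real.sqrt (‖k‖ ^ 2 + m ^ 2) := by
    intro k hk
    have h := (sommerfeldWeyl_subordination hk ht).2
    rw [Real.sq_sqrt (by positivity)] at h
    simpa only [hG, hν] using h
  -- integrability of `G` on the product (Tonelli criterion, Gaussian sections)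
  have hGint : Integrable G ((volume : Measure (EuclideanSpace ℝ (Fin 2))).prod ν) := by
    refine (integrable_prod_iff' hGm.aestronglyMeasurable).2 ⟨?_, ?_⟩
    · rw [hν]
      filter_upwards [ae_restrict_mem measurableSet_Ioi] with u hu
      exact (sommerfeldWeyl_gauss_section hu m t 0 0).1
    · have hI := sommerfeldWeyl_radial_integrable m ht
      rw [hν]
      refine hI.congr_fun (fun u hu => ?_) measurableSet_Ioi
      have hu0 : (0 : ℝ) < u := hu
      have hnn : ∀ k : EuclideanSpace ℝ (Fin 2), 0 ≤ G (k, u) := fun k => by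
        simp only [hG]; positivity
      have hval := (sommerfeldWeyl_gauss_section hu0 m t 0 0).2
      simp only [mul_zero, add_zero, Real.cos_zero, one_mul, zero_pow two_ne_zero, zero_div,
        neg_zero, Real.exp_zero, mul_one] at hval
      simp only
      rw [integral_congr_ae (ae_of_all _ fun k => Real.norm_of_nonneg (hnn k))]
      simp only [hG]
      rw [hval]
  -- hence integrability of `F = cos · G`
  have hFint : Integrable F ((volume : Measure (EuclideanSpace ℝ (Fin 2))).prod ν) := by
    refine hGint.mono hFm.aestronglyMeasurable (ae_of_all _ fun p => ?_)
    simp only [hF]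
    rw [norm_mul, Real.norm_eq_abs]
    exact mul_le_of_le_one_left (norm_nonneg _) (Real.abs_cos_le_one _)
  -- (1) `k` outer: `∫ F = √π · ∫ cos(k·w) e^{-Ω|t|}/Ω d²k`
  have hk_outer : ∫ p, F p ∂((volume : Measure (EuclideanSpace ℝ (Fin 2))).prod ν) =
      Real.sqrt Real.pi * ∫ k : EuclideanSpace ℝ (Fin 2), Real.cos (k 0 * a + k 1 * b) *
        (Real.exp (-(Real.sqrt (‖k‖ ^ 2 + m ^ 2) * |t|)) / Real.sqrt (‖k‖ ^ 2 + m ^ 2)) := by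
    rw [integral_prod F hFint, ← integral_const_mul]
    refine integral_congr_ae ?_
    filter_upwards [hΩae] with k hk
    simp only [hF]
    rw [integral_const_mul, hGu k hk]
    ring
  -- (2) `u` outer: `∫ F = 2π√π e^{-mr}/r`
  have hu_outer : ∫ p, F p ∂((volume : Measure (EuclideanSpace ℝ (Fin 2))).prod ν) =
      2 * Real.pi * Real.sqrt Real.pi * Real.exp (-(m * Real.sqrt (a ^ 2 + b ^ 2 + t ^ 2))) /
        Real.sqrt (a ^ 2 + b ^ 2 + t ^ 2) := by
    rw [integral_prod_symm F hFint, ← sommerfeldWeyl_radial_integral hm ht a b, hν]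
    refine setIntegral_congr_fun measurableSet_Ioi fun u hu => ?_
    simp only [hF, hG]
    exact (sommerfeldWeyl_gauss_section hu m t a b).2
  have hsqrtpi : Real.sqrt Real.pi ≠ 0 := (Real.sqrt_pos.2 Real.pi_pos).ne'
  refine ⟨?_, ?_⟩
  · -- integrability of `e^{-Ω|t|}/Ω`, from the integrability of `k ↦ ∫ G(k,u) du`
    have h1 : Integrable (fun k : EuclideanSpace ℝ (Fin 2) => ∫ u, G (k, u) ∂ν) volume :=
      hGint.integral_prod_left
    have h2 : Integrable (fun k : EuclideanSpace ℝ (Fin 2) => Real.sqrt Real.pi *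
        (Real.exp (-(Real.sqrt (‖k‖ ^ 2 + m ^ 2) * |t|)) / Real.sqrt (‖k‖ ^ 2 + m ^ 2))) volume := by
      refine h1.congr ?_
      filter_upwards [hΩae] with k hk
      rw [hGu k hk]
      ring
    have h3 := h2.const_mul (Real.sqrt Real.pi)⁻¹
    refine h3.congr (ae_of_all _ fun k => ?_)
    simp only
    rw [← mul_assoc, inv_mul_cancel₀ hsqrtpi, one_mul]
  · have h := hk_outer.symm.trans hu_outer
    have h' : Real.sqrt Real.pi * (∫ k : EuclideanSpace ℝ (Fin 2), Real.cos (k 0 * a + k 1 * b) *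
        (Real.exp (-(Real.sqrt (‖k‖ ^ 2 + m ^ 2) * |t|)) / Real.sqrt (‖k‖ ^ 2 + m ^ 2))) =
        Real.sqrt Real.pi * (2 * Real.pi * Real.exp (-(m * Real.sqrt (a ^ 2 + b ^ 2 + t ^ 2))) /
          Real.sqrt (a ^ 2 + b ^ 2 + t ^ 2)) := by
      rw [h]; ring
    exact mul_left_cancel₀ hsqrtpi h'

end Summit.CriticalPhenomena.Ising3DConformalLimit.Cruxes.UnitSpeedTwoPoint.YukawaSubordination

end
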